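import Summits.QuantumFields.YangMills.Theses.SandwichVariancePinching

/-!
# Assembly of route `SandwichVariancePinching` (planner seat ym-idea-3 g12; route status draft at the time of writing)

The route file's kernel-checked deciding theorem `closes` packaged as the proof of the route's `Assembly` item (stmt-QuantumFields-28263):
the recorded implication from the route's items to `LogConcaveChart.QuadraticCovarianceComparison` (an open crux decl of another route, not the summit Statement).  No summit, no rung and no crux is proved here; every crux of the route
stays open.  Width seat ym-line-sfw-p2-w2 g20 (cell `ym-idea-1`, free hands).
-/

namespace Summit.QuantumFields.YangMills.Theorems

open Summit.QuantumFields.YangMills.Theses.SandwichVariancePinching in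
/-- The `Assembly` item of route `SandwichVariancePinching` holds: it is the route's deciding theorem `closes` read as an implication. [folklore] -/
theorem sandwichVariancePinching_assembly : Summit.QuantumFields.YangMills.Theses.SandwichVariancePinching.Assembly :=
  -- Route rev 3/4 (2026-08-28T15:42–15:48Z) dropped the REFUTED crux `SandwichMoments` (δ ≤ 1; `not_SandwichMoments`, witness δ = 1)
  -- and re-keyed `closes` to `SandwichMomentsLt` (same body, strict δ < 1); this item's statement still carries `SandwichMoments`,
  -- which implies the strict version a fortiori. Statement unchanged.
  fun h1 h2 hS hN => closes h1 h2 (fun δ hδ hδ1 => hS δ hδ hδ1.le) hN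

end Summit.QuantumFields.YangMills.Theorems
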